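import Literature.MathematicalPhysics.QuantumFieldTheory.ConformalBootstrap3D.MixedCertificateObligations
import Literature.MathematicalPhysics.QuantumFieldTheory.ConformalBootstrap3D.BlockRadialCoordinate
import HarnessLib

/-!
# The odd sector of a mixed `σ–ε` point certificate in the RADIAL frame (conditional skeleton)

The landed odd-sector device (`MixedOddTail`, `MixedOddHead`) works in the `z`-frame and budgets the
`⟨σεσε⟩` row at its Cauchy–Schwarz worst case. This file records, as theorems with EXPLICIT HYPOTHESES,
the alternative in the radial coordinate `ρ(z) = z/(1+√(1-z))²` of Hogervorst–Rychkov 2013 §3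
(`BlockRadialCoordinate`): by Costa–Hansen–Penedones–Trevisani 2016 §2.1–2.2 the prefactored `⟨εσσε⟩`
block `𝒢̃ = v^{Δ_σε/2}·g^{-Δ_σε,Δ_σε}_{Δ,ℓ}` (`v = (1-z)(1-z̄)`, `Δ_σε = Δ_σ - Δ_ε`) has a radial expansion
`𝒢̃ = 4^Δ Σ_{m,j} w_{m,j} r^{Δ+m} P_j(η)` whose coefficients are non-negative by unitarity, and by the
`x₁ ↔ x₂` relation of Dolan–Osborn 2011 eq. (2.23) (`z ↦ z/(z-1)` is `ρ ↦ -ρ`) the `⟨σεσε⟩` block is the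
SAME series with the level signs `(-1)^m` and no prefactor: `g^{Δ_σε,Δ_σε}_{Δ,ℓ} = 4^Δ Σ_m (-1)^m Σ_j w_{m,j}
r^{Δ+m}P_j(η)` (pub-ising3d AXIOMS-SOURCES §11: exact as formal series; CHPT's 30-point recurrence = the
`z → ρ` conversion of the tree's `hrCoeffAB` arrays, 345 coefficients, 0 mismatches; `w ≥ 0` checked on
750 coefficients). Here `r^{E}P_j(η) = zMono E j ρ ρ̄` (`radialMono`).

Neither expansion is derivable from the tree's `z`-frame block predicate `IsConformalBlock3D` (that would be
analytic continuation from the unit `z`-bidisc to the unit `ρ`-bidisc), so both enter as HYPOTHESES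
(`HasSignedRadialExpansion`, `HasRadialExpansion`) on the pair of blocks — exactly what a radial block
clause "A2ρ" would have to supply (pub-ising3d RADIAL-FRAME-DESIGN.md). Under them:

* `hasSum_oddForm_radial` — the EXACT identity `α⃗·V⃗_{-,Δ,ℓ} = Σ_{(m,j)} 𝔗_{m,j}` for a point 5-vector,
  `𝔗_{m,j} = 4^Δ w_{m,j} · ((-1)^{ℓ+m} Φ³[F^{s}_-[𝒫^ρ_{Δ+m,j}]] + Φ⁴[F^{Δσ}_-[v^{-Δσε/2}𝒫^ρ_{Δ+m,j}]]
  - Φ⁵[F^{Δσ}_+[v^{-Δσε/2}𝒫^ρ_{Δ+m,j}]])` (`oddTermRadial`; no inequality used);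
* `oddTermRadial_nonneg_of_abs_le` — the parity-UNIFORM termwise rule: `w_{m,j} ≥ 0` and
  `|Φ³-part| ≤ Φ⁴⁵-part` ⇒ `𝔗_{m,j} ≥ 0` (the `⟨σεσε⟩` row enters with its SIGNED node sum and its `F_-`
  difference intact, coefficient ratio exactly `1` — compare `oddTermForm_nonneg_of_abs_le`, where the
  `z`-frame ratio `|A^{gmm}|/A^{gpm}` is unbounded near twist `1+|Δ_σε|`);
* `oddForm_nonneg_of_radial_termwise` (head + termwise tail) and `oddPositive_of_radial` (the `OddPositive`
  obligation, given that EVERY typed pair of blocks at `(Δ, ℓ)` carries the two expansions with a common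
  non-negative table — the content of the would-be clause A2ρ).

Nothing here asserts that typed blocks have radial expansions; no named fact is introduced.
-/

namespace Literature.MathematicalPhysics.QuantumFieldTheory.ConformalBootstrap3D

open Finset Set

/-! ### Radial monomials as functions on the `z`-square and the two expansion hypotheses -/

/-- `𝒫^ρ_{E,j}(z,z̄) := r^E P_j(η)` at the radial image of `(z, z̄)`, i.e. `zMono E j (ρ(z)) (ρ(z̄))`
(Hogervorst–Rychkov 2013 §3 eq. (3.4)–(3.5); Costa–Hansen–Penedones–Trevisani 2016 eq. (2.11) at
`d = 3`, `𝒞_j = P_j`). [cite: HogervorstRychkov2013, §3 eq. (3.4)] -/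
noncomputable def radialMono (E : ℝ) (j : ℕ) (x y : ℝ) : ℝ :=
  zMono E j (rhoOf x) (rhoOf y)

/-- `𝒫^ρ_{E,j} ≥ 0` at real points of the square. [folklore] -/
theorem radialMono_nonneg (E : ℝ) (j : ℕ) {x y : ℝ} (hx : 0 ≤ x) (hy : 0 ≤ y) :
    0 ≤ radialMono E j x y :=
  zMono_nonneg E j (rhoOf_nonneg hx) (rhoOf_nonneg hy)

/-- `v^{-c}·𝒫^ρ_{E,j}`, `v = (1-z)(1-z̄)`: the radial monomial as it enters the `⟨εσσε⟩` rows
(`g^{-Δσε,Δσε} = v^{-Δσε/2}·𝒢̃`, `c = Δσε/2`). [cite: CostaHansenPenedonesTrevisani2016, §2.2 eq. (2.19)] -/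
noncomputable def radialMonoV (c E : ℝ) (j : ℕ) (x y : ℝ) : ℝ :=
  ((1 - x) * (1 - y)) ^ (-c) * radialMono E j x y

/-- **Radial expansion hypothesis** (the prefactored block): on the open square
`((1-z)(1-z̄))^c · g(z,z̄) = Σ_{(m,j)} 4^Δ w(m,j) 𝒫^ρ_{Δ+m,j}(ρ(z),ρ(z̄))` as an unconditionally convergent
double series. For the `⟨εσσε⟩` block `g = g^{-Δσε,Δσε}_{Δ,ℓ}` with `c = Δσε/2` this is the expansion of
Costa–Hansen–Penedones–Trevisani 2016 eq. (2.11) of their prefactored block (eq. (2.19)–(2.20)); it is a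
HYPOTHESIS here, not a consequence of `IsConformalBlock3D`. [cite: CostaHansenPenedonesTrevisani2016, §2.1 eq. (2.11)] -/
def HasRadialExpansion (c Δ : ℝ) (w : ℕ × ℕ → ℝ) (g : ℝ → ℝ → ℝ) : Prop :=
  ∀ x y : ℝ, x ∈ Ioo (0 : ℝ) 1 → y ∈ Ioo (0 : ℝ) 1 →
    HasSum (fun q : ℕ × ℕ => (4 : ℝ) ^ Δ * w q * radialMono (Δ + (q.1 : ℝ)) q.2 x y)
      (((1 - x) * (1 - y)) ^ c * g x y)

/-- **Signed radial expansion hypothesis** (the `⟨σεσε⟩` block): on the open square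
`g(z,z̄) = Σ_{(m,j)} 4^Δ (-1)^m w(m,j) 𝒫^ρ_{Δ+m,j}(ρ(z),ρ(z̄))` — the `x₁ ↔ x₂` image of the prefactored
`⟨εσσε⟩` expansion (Dolan–Osborn 2011 eq. (2.23): `g^{s,s} = (-1)^ℓ v^{-s/2} g^{-s,s}∘(z ↦ z/(z-1))`, with
`z/(z-1) ↔ -ρ` and `𝒫_{E,j}(-ρ,-ρ̄) = (-1)^j 𝒫_{E,j}(ρ,ρ̄)`, `zMono_neg_neg`). A HYPOTHESIS here.
[cite: DolanOsborn2011, §2 eq. (2.23)] -/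
def HasSignedRadialExpansion (Δ : ℝ) (w : ℕ × ℕ → ℝ) (g : ℝ → ℝ → ℝ) : Prop :=
  ∀ x y : ℝ, x ∈ Ioo (0 : ℝ) 1 → y ∈ Ioo (0 : ℝ) 1 →
    HasSum (fun q : ℕ × ℕ => (4 : ℝ) ^ Δ * (-1 : ℝ) ^ q.1 * w q * radialMono (Δ + (q.1 : ℝ)) q.2 x y)
      (g x y)

/-- From the prefactored expansion to the block itself: `g = Σ 4^Δ w(m,j) · v^{-c}𝒫^ρ_{Δ+m,j}` on the
square. [folklore] -/
theorem HasRadialExpansion.hasSum_self {c Δ : ℝ} {w : ℕ × ℕ → ℝ} {g : ℝ → ℝ → ℝ}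
    (h : HasRadialExpansion c Δ w g) {x y : ℝ} (hx : x ∈ Ioo (0 : ℝ) 1) (hy : y ∈ Ioo (0 : ℝ) 1) :
    HasSum (fun q : ℕ × ℕ => (4 : ℝ) ^ Δ * w q * radialMonoV c (Δ + (q.1 : ℝ)) q.2 x y) (g x y) := by
  have hv : 0 < (1 - x) * (1 - y) := mul_pos (by linarith [hx.2]) (by linarith [hy.2])
  have hvc : ((1 - x) * (1 - y)) ^ (-c) * ((1 - x) * (1 - y)) ^ c = 1 := by
    rw [Real.rpow_neg hv.le, inv_mul_cancel₀ (Real.rpow_pos_of_pos hv c).ne']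
  have h1 := (h x y hx hy).mul_left (((1 - x) * (1 - y)) ^ (-c))
  rw [← mul_assoc, hvc, one_mul] at h1
  refine h1.congr_fun fun q => ?_
  simp only [radialMonoV]
  ring

/-! ### Point functionals on scaled families -/

/-- `φ_w[F^{s}_{sign}[c·G]] = c·φ_w[F^{s}_{sign}[G]]`. [folklore] -/
theorem pointFunctional_crossF_const_mul {N : ℕ} (w z zb : Fin N → ℝ) (s sign c : ℝ)
    (G : ℝ → ℝ → ℝ) :
    pointFunctional w z zb (crossF s sign (fun x y => c * G x y)) =
      c * pointFunctional w z zb (crossF s sign G) := by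
  simp only [pointFunctional_apply, crossF_const_mul, Finset.mul_sum]
  refine Finset.sum_congr rfl fun k _ => ?_
  ring

/-! ### The radial odd term and the exact decomposition -/

/-- The `⟨σεσε⟩`-row part at radial index `(E, j)`: `Φ³(E,j) = φ_{w³}[F^{s}_-[𝒫^ρ_{E,j}]]`, `s = (Δσ+Δε)/2`
(a SIGNED finite sum over the nodes, `F_-` difference intact). [folklore] -/
noncomputable def radialOdd3 {N : ℕ} (z zb : Fin N → ℝ) (w : Fin 5 → Fin N → ℝ) (Δσ Δε E : ℝ)
    (j : ℕ) : ℝ :=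
  pointFunctional (w 2) z zb (crossF ((Δσ + Δε) / 2) (-1) (radialMono E j))

/-- The `⟨εσσε⟩`-rows part at radial index `(E, j)`:
`Φ⁴⁵(E,j) = φ_{w⁴}[F^{Δσ}_-[v^{-Δσε/2}𝒫^ρ_{E,j}]] - φ_{w⁵}[F^{Δσ}_+[v^{-Δσε/2}𝒫^ρ_{E,j}]]`. [folklore] -/
noncomputable def radialOdd45 {N : ℕ} (z zb : Fin N → ℝ) (w : Fin 5 → Fin N → ℝ) (Δσ Δε E : ℝ)
    (j : ℕ) : ℝ :=
  pointFunctional (w 3) z zb (crossF Δσ (-1) (radialMonoV ((Δσ - Δε) / 2) E j)) -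
    pointFunctional (w 4) z zb (crossF Δσ 1 (radialMonoV ((Δσ - Δε) / 2) E j))

/-- **The radial odd term** `𝔗_{m,j} = 4^Δ w(m,j) · ((-1)^{ℓ+m} Φ³(Δ+m,j) + Φ⁴⁵(Δ+m,j))`.
[cite: KosPolandSimmonsduffin2014, §3.2 eq. (3.13)] -/
noncomputable def oddTermRadial {N : ℕ} (z zb : Fin N → ℝ) (w : Fin 5 → Fin N → ℝ) (Δσ Δε Δ : ℝ)
    (wr : ℕ × ℕ → ℝ) (ℓ : ℕ) (q : ℕ × ℕ) : ℝ :=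
  (4 : ℝ) ^ Δ * wr q *
    ((-1 : ℝ) ^ (ℓ + q.1) * radialOdd3 z zb w Δσ Δε (Δ + (q.1 : ℝ)) q.2 +
      radialOdd45 z zb w Δσ Δε (Δ + (q.1 : ℝ)) q.2)

/-- **Exact radial decomposition of the odd sector.** For a point 5-vector with nodes in the open square
and a pair `(g₁, g₂)` carrying the signed / prefactored radial expansions with a COMMON table `wr`
(`g₁ = ⟨σεσε⟩` block, `g₂ = ⟨εσσε⟩` block, prefactor exponent `Δσε/2`):
`α⃗·V⃗_{-,Δ,ℓ}(g₁,g₂) = Σ_{(m,j)} 𝔗_{m,j}` (unconditionally convergent). No inequality is used.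
[cite: KosPolandSimmonsduffin2014, §3.2 eq. (3.13)] -/
theorem hasSum_oddForm_radial {N : ℕ} (z zb : Fin N → ℝ) (w : Fin 5 → Fin N → ℝ)
    (hz : ∀ k, z k ∈ Ioo (0 : ℝ) 1) (hzb : ∀ k, zb k ∈ Ioo (0 : ℝ) 1) {Δσ Δε Δ : ℝ} {ℓ : ℕ}
    {wr : ℕ × ℕ → ℝ} {g₁ g₂ : ℝ → ℝ → ℝ} (h₁ : HasSignedRadialExpansion Δ wr g₁)
    (h₂ : HasRadialExpansion ((Δσ - Δε) / 2) Δ wr g₂) :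
    HasSum (oddTermRadial z zb w Δσ Δε Δ wr ℓ)
      ((CrossingFunctional.ofPoints z zb w).oddForm Δσ Δε ℓ g₁ g₂) := by
  -- pointwise families on the square
  have hp₁ : ∀ x y : ℝ, x ∈ Ioo (0 : ℝ) 1 → y ∈ Ioo (0 : ℝ) 1 →
      HasSum (fun q : ℕ × ℕ => (fun x' y' => ((4 : ℝ) ^ Δ * (-1 : ℝ) ^ q.1 * wr q) *
        radialMono (Δ + (q.1 : ℝ)) q.2 x' y') x y) (g₁ x y) :=
    fun x y hx hy => h₁ x y hx hy
  have hp₂ : ∀ x y : ℝ, x ∈ Ioo (0 : ℝ) 1 → y ∈ Ioo (0 : ℝ) 1 →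
      HasSum (fun q : ℕ × ℕ => (fun x' y' => ((4 : ℝ) ^ Δ * wr q) *
        radialMonoV ((Δσ - Δε) / 2) (Δ + (q.1 : ℝ)) q.2 x' y') x y) (g₂ x y) :=
    fun x y hx hy => h₂.hasSum_self hx hy
  -- apply the three point functionals
  have h3 := evaluationContinuous_pointFunctional (w 2) z zb hz hzb (ℕ × ℕ) _ _
    (fun x y hx hy => hasSum_crossF ((Δσ + Δε) / 2) (-1) hp₁ hx hy)
  have h4 := evaluationContinuous_pointFunctional (w 3) z zb hz hzb (ℕ × ℕ) _ _
    (fun x y hx hy => hasSum_crossF Δσ (-1) hp₂ hx hy)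
  have h5 := evaluationContinuous_pointFunctional (w 4) z zb hz hzb (ℕ × ℕ) _ _
    (fun x y hx hy => hasSum_crossF Δσ 1 hp₂ hx hy)
  simp only [pointFunctional_crossF_const_mul] at h3 h4 h5
  have hs := (h3.mul_left ((-1 : ℝ) ^ ℓ)).add (h4.sub h5)
  have hL : (CrossingFunctional.ofPoints z zb w).oddForm Δσ Δε ℓ g₁ g₂ =
      (-1 : ℝ) ^ ℓ * pointFunctional (w 2) z zb (crossF ((Δσ + Δε) / 2) (-1) g₁) +
        (pointFunctional (w 3) z zb (crossF Δσ (-1) g₂) -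
          pointFunctional (w 4) z zb (crossF Δσ 1 g₂)) := by
    simp only [CrossingFunctional.oddForm, CrossingFunctional.ofPoints]
    ring
  rw [hL]
  refine hs.congr_fun fun q => ?_
  simp only [oddTermRadial, radialOdd3, radialOdd45, pow_add]
  ring

/-! ### Termwise rules -/

/-- **Parity-uniform termwise rule.** If `w(m,j) ≥ 0` (radial reflection positivity of the `⟨εσσε⟩`
matrix element, Costa–Hansen–Penedones–Trevisani 2016 §2.1) and the `⟨εσσε⟩` rows dominate the SIGNED
`⟨σεσε⟩` row at the radial index, `|Φ³(Δ+m,j)| ≤ Φ⁴⁵(Δ+m,j)`, then `𝔗_{m,j} ≥ 0` for BOTH values of the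
sign `(-1)^{ℓ+m}`. [cite: CostaHansenPenedonesTrevisani2016, §2.1] -/
theorem oddTermRadial_nonneg_of_abs_le {N : ℕ} (z zb : Fin N → ℝ) (w : Fin 5 → Fin N → ℝ)
    (Δσ Δε Δ : ℝ) {wr : ℕ × ℕ → ℝ} (ℓ : ℕ) (q : ℕ × ℕ) (hw : 0 ≤ wr q)
    (hdom : |radialOdd3 z zb w Δσ Δε (Δ + (q.1 : ℝ)) q.2| ≤
      radialOdd45 z zb w Δσ Δε (Δ + (q.1 : ℝ)) q.2) :
    0 ≤ oddTermRadial z zb w Δσ Δε Δ wr ℓ q := by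
  unfold oddTermRadial
  have h4 : (0 : ℝ) ≤ (4 : ℝ) ^ Δ := Real.rpow_nonneg (by norm_num) Δ
  refine mul_nonneg (mul_nonneg h4 hw) ?_
  have hsgn : -|radialOdd3 z zb w Δσ Δε (Δ + (q.1 : ℝ)) q.2| ≤
      (-1 : ℝ) ^ (ℓ + q.1) * radialOdd3 z zb w Δσ Δε (Δ + (q.1 : ℝ)) q.2 := by
    rcases neg_one_pow_eq_or ℝ (ℓ + q.1) with h | h
    · rw [h, one_mul]; exact neg_abs_le _
    · rw [h, neg_one_mul]; exact neg_le_neg (le_abs_self _)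
  linarith

/-- **Sign-resolved termwise rule** (one block, parity of `ℓ + m` known): `w(m,j) ≥ 0` and
`0 ≤ (-1)^{ℓ+m} Φ³ + Φ⁴⁵` ⇒ `𝔗_{m,j} ≥ 0`. [folklore] -/
theorem oddTermRadial_nonneg_of_nonneg {N : ℕ} (z zb : Fin N → ℝ) (w : Fin 5 → Fin N → ℝ)
    (Δσ Δε Δ : ℝ) {wr : ℕ × ℕ → ℝ} (ℓ : ℕ) (q : ℕ × ℕ) (hw : 0 ≤ wr q)
    (h : 0 ≤ (-1 : ℝ) ^ (ℓ + q.1) * radialOdd3 z zb w Δσ Δε (Δ + (q.1 : ℝ)) q.2 +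
      radialOdd45 z zb w Δσ Δε (Δ + (q.1 : ℝ)) q.2) :
    0 ≤ oddTermRadial z zb w Δσ Δε Δ wr ℓ q :=
  mul_nonneg (mul_nonneg (Real.rpow_nonneg (by norm_num) Δ) hw) h

/-- **`α⃗·V⃗_- ≥ 0` from a finite head of radial terms plus termwise non-negativity off the head**, for a
pair `(g₁, g₂)` carrying the two radial expansions with a common table. [cite: KosPolandSimmonsduffin2014, §3.2 eq. (3.13)] -/
theorem oddForm_nonneg_of_radial_termwise {N : ℕ} (z zb : Fin N → ℝ) (w : Fin 5 → Fin N → ℝ)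
    (hz : ∀ k, z k ∈ Ioo (0 : ℝ) 1) (hzb : ∀ k, zb k ∈ Ioo (0 : ℝ) 1) {Δσ Δε Δ : ℝ} {ℓ : ℕ}
    {wr : ℕ × ℕ → ℝ} {g₁ g₂ : ℝ → ℝ → ℝ} (h₁ : HasSignedRadialExpansion Δ wr g₁)
    (h₂ : HasRadialExpansion ((Δσ - Δε) / 2) Δ wr g₂) (F : Finset (ℕ × ℕ))
    (hhead : 0 ≤ ∑ q ∈ F, oddTermRadial z zb w Δσ Δε Δ wr ℓ q)
    (htail : ∀ q : ℕ × ℕ, q ∉ F → 0 ≤ oddTermRadial z zb w Δσ Δε Δ wr ℓ q) :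
    0 ≤ (CrossingFunctional.ofPoints z zb w).oddForm Δσ Δε ℓ g₁ g₂ :=
  hhead.trans (sum_le_hasSum F (fun q hq => htail q hq) (hasSum_oddForm_radial z zb w hz hzb h₁ h₂))

/-- **All-terms version**: `w ≥ 0` and `|Φ³| ≤ Φ⁴⁵` at every radial index ⇒ `α⃗·V⃗_- ≥ 0` for the pair.
[cite: CostaHansenPenedonesTrevisani2016, §2.1] -/
theorem oddForm_nonneg_of_radial_abs_le {N : ℕ} (z zb : Fin N → ℝ) (w : Fin 5 → Fin N → ℝ)
    (hz : ∀ k, z k ∈ Ioo (0 : ℝ) 1) (hzb : ∀ k, zb k ∈ Ioo (0 : ℝ) 1) {Δσ Δε Δ : ℝ} {ℓ : ℕ}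
    {wr : ℕ × ℕ → ℝ} {g₁ g₂ : ℝ → ℝ → ℝ} (h₁ : HasSignedRadialExpansion Δ wr g₁)
    (h₂ : HasRadialExpansion ((Δσ - Δε) / 2) Δ wr g₂) (hw : ∀ q, 0 ≤ wr q)
    (hdom : ∀ q : ℕ × ℕ, |radialOdd3 z zb w Δσ Δε (Δ + (q.1 : ℝ)) q.2| ≤
      radialOdd45 z zb w Δσ Δε (Δ + (q.1 : ℝ)) q.2) :
    0 ≤ (CrossingFunctional.ofPoints z zb w).oddForm Δσ Δε ℓ g₁ g₂ :=
  (hasSum_oddForm_radial z zb w hz hzb h₁ h₂).nonneg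
    fun q => oddTermRadial_nonneg_of_abs_le z zb w Δσ Δε Δ ℓ q (hw q) (hdom q)

/-- **The `OddPositive` obligation in the radial frame**, given what a radial block clause would supply:
EVERY typed pair of odd-sector blocks at `(Δ, ℓ)` carries the two radial expansions with a common
non-negative table (Costa–Hansen–Penedones–Trevisani 2016 §2.1 positivity + Dolan–Osborn 2011 (2.23)).
With the parity-uniform termwise rule this discharges (D4)/(D5)-type obligations for the pair of rows.
[cite: KosPolandSimmonsduffin2014, §3.3 eq. (3.16)] -/
theorem oddPositive_of_radial {N : ℕ} (z zb : Fin N → ℝ) (w : Fin 5 → Fin N → ℝ)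
    (hz : ∀ k, z k ∈ Ioo (0 : ℝ) 1) (hzb : ∀ k, zb k ∈ Ioo (0 : ℝ) 1) {Δσ Δε Δ : ℝ} {ℓ : ℕ}
    (hρ : ∀ g₁ g₂ : ℝ → ℝ → ℝ, IsConformalBlock3D (Δσ - Δε) (Δσ - Δε) Δ ℓ g₁ →
      IsConformalBlock3D (-(Δσ - Δε)) (Δσ - Δε) Δ ℓ g₂ →
        ∃ wr : ℕ × ℕ → ℝ, (∀ q, 0 ≤ wr q) ∧ HasSignedRadialExpansion Δ wr g₁ ∧
          HasRadialExpansion ((Δσ - Δε) / 2) Δ wr g₂)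
    (hdom : ∀ q : ℕ × ℕ, |radialOdd3 z zb w Δσ Δε (Δ + (q.1 : ℝ)) q.2| ≤
      radialOdd45 z zb w Δσ Δε (Δ + (q.1 : ℝ)) q.2) :
    (CrossingFunctional.ofPoints z zb w).OddPositive Δσ Δε Δ ℓ := by
  intro g₁ g₂ hg₁ hg₂
  obtain ⟨wr, hw, h₁, h₂⟩ := hρ g₁ g₂ hg₁ hg₂
  exact oddForm_nonneg_of_radial_abs_le z zb w hz hzb h₁ h₂ hw hdom

end Literature.MathematicalPhysics.QuantumFieldTheory.ConformalBootstrap3D
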